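import Mathlib.Tactic.DeriveFintype
import Literature.Computability.Complexity.Oracle
import Literature.Computability.Complexity.TimeBoundsProofs
import Literature.Computability.Complexity.NondeterministicProofs
import HarnessLib

/-!
# Karp reducibility implies Cook reducibility (discharge of `PolyTimeKarpReducible.turing`)

Sibling proof file of `Oracle.lean` (D-0014: named facts `def X : Prop` are discharged as
`theorem X_holds : X`). It discharges

* `Literature.CplxCore.PolyTimeKarpReducible.turing_holds : PolyTimeKarpReducible.turing` —
  `L₁ ≤ₚ L₂ → L₁ ≤ᵀₚ L₂`;

and, as one-line corollaries (`≤ₚ` is reflexive, `PolyTimeKarpReducible.refl`),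

* `Literature.CplxCore.self_mem_PRel_ofLanguage_holds : self_mem_PRel_ofLanguage` (`A ∈ P^A`);
* `Literature.CplxCore.polyTimeTuringReducible_refl_holds : polyTimeTuringReducible_refl`;
* `Literature.CplxCore.self_subset_PRelClass_holds : self_subset_PRelClass` (`C ⊆ P^C`);

and, with the one-statement tagging machine `ConsTM.machine` (`push true; halt`), the wrapper
`boolUnpairFstLift` of `NondeterministicProofs.lean` and `PolyTimeComputable.comp_holds`, the
query-free facts (Baker–Gill–Solovay 1975, §1: `P ⊆ P^X`)

* `Literature.CplxCore.OracleAlg.isPolyTime_ofFun_holds : OracleAlg.isPolyTime_ofFun`;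
* `Literature.CplxCore.P_subset_PRel_holds : P_subset_PRel` (`P ⊆ P^O`);
* `Literature.CplxCore.P_subset_PRelClass_holds : P_subset_PRelClass` (`P ⊆ P^C`, `C ≠ ∅`).

Source: R. E. Ladner, N. A. Lynch, A. L. Selman, *A comparison of polynomial time
reducibilities*, Theoret. Comput. Sci. 1 (1975) 103–123. The printed argument (p. 104): "A set
`A` is many-one reducible to `B` in polynomial time (`A ≤ᴾₘ B`) if there is a function `f`
computable in polynomial time such that `x ∈ A` iff `f(x) ∈ B`. Hence a many-one reduction
procedure entails exactly one membership question of the oracle."; the comparison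
`≤ᴾₘ ⇒ ≤ᴾᴛ` is then listed among the "important yet easily proved properties" of §2
(Prop. 2.1, p. 107: "The proof of Proposition 2.1 is routine."). In the transcript model of
`Oracle.lean` the reduction procedure is the oracle algorithm `karpAlg f`: on the empty
transcript ask the query `f x`, on a non-empty transcript output the (first bit of the) first
answer. The only non-trivial point is that its *step function* is polynomial-time computable on
the `boolPair`-encoded pair (input, transcript) (`OracleAlg.IsPolyTime`); this needs an actual
multi-stack machine, built here around a Mathlib machine `M` for `f`.

## The machine (`KarpTM.machine`)

Given a bundled Mathlib machine `tm : Turing.FinTM2` whose input and output alphabets are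
identified with `Bool` (`e`, `eo`), the wrapped machine has the stacks of `tm` plus one auxiliary
`Bool` stack (index `Sum.inr ()`), labels `tm.Λ ⊕ KarpTM.Label`, states
`tm.σ × Bool × Bool` (two one-bit registers). On the input word
`w = boolPair x (listBool.encode answers)` it

1. (`read`) pops the input two symbols at a time, pushing `b` on the auxiliary stack for each
   doubled pair `bb`, until the separator `01` (so the auxiliary stack holds `x` reversed);
2. (`test`) pops one more symbol: it is `true` iff the transcript `answers` is non-empty
   (the unary length field of `listBool` starts with a doubled `1`), `false` iff it is empty;
3. non-empty transcript: (`skip`) pops the rest of the unary length field up to its separator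
   `01` and reads the next bit — the first bit of the doubled first answer, i.e.
   `a.headD false` for the first answer `a` —, (`drain`) discards the rest of the input,
   (`out`) discards the auxiliary stack and halts with output `[true, a.headD false]`;
4. empty transcript: (`restore`) moves the auxiliary stack onto the input stack of `tm`
   (restoring the order of `x`), runs `tm` (its statements translated by
   `TM2Comp.trStmt₁`, whose `halt` is a jump to the label `tag`), and (`tag`) pushes the tag
   bit `false` on top of the output `f x` and halts.

Phases 1–3 take at most `|w|` steps, phases 1, 2, 4 take `2|x| + 4 ≤ |w|` steps plus the running
time of `tm`, so the step function runs in time `n + p(n)` (`isPolyTime_karpAlg`).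
The simulation of `tm` inside the wrapped machine is Mathlib-style bookkeeping reused from
`TimeBoundsProofs.lean` (`TM2Comp.trStmt₁`, `TM2Comp.cfg₁`, `TM2Comp.stepAux_trStmt₁`,
`TM2Comp.iterate_bind_map`); the phase lemmas follow the pattern of
`NondeterministicProofs.lean` (`PairFstTM`).

## References

* R. E. Ladner, N. A. Lynch, A. L. Selman, *A comparison of polynomial time reducibilities*,
  Theoret. Comput. Sci. 1 (1975) 103–123, p. 104 and §2, Prop. 2.1.
* S. Arora, B. Barak, *Computational Complexity: A Modern Approach*, CUP 2009, §3.4 (oracle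
  machines), Claim 2.4 (ignoring part of the input).
* T. Baker, J. Gill, R. Solovay, *Relativizations of the P =? NP question*, SIAM J. Comput. 4
  (1975), §1 (`P ⊆ P^X`).
-/

namespace Literature.Computability.Complexity.KarpTM

open Turing StateTransition Function TM2Comp

/-- Labels of the wrapper phases of `KarpTM.machine` (see the module docstring). [folklore] -/
inductive Label
  | read
  | test
  | skip
  | drain
  | out
  | restore
  | tag
  deriving DecidableEq, Fintype

variable (tm : FinTM2) (e : tm.Γ tm.k₀ ≃ Bool) (eo : tm.Γ tm.k₁ ≃ Bool)

/-- Alphabets of the auxiliary stacks: one `Bool` stack. [folklore] -/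
abbrev AuxΓ : Unit → Type := fun _ => Bool

/-- Stack alphabets of the wrapped machine: the old stacks on the left, the auxiliary `Bool`
stack on the right (`TM2Comp.CompΓ`). [folklore] -/
abbrev Alph : tm.K ⊕ Unit → Type := CompΓ tm.Γ AuxΓ

/-- States of the wrapped machine: an old state and two one-bit registers. [folklore] -/
abbrev State : Type := tm.σ × Bool × Bool

/-- Labels of the wrapped machine: old labels and the wrapper labels. [folklore] -/
abbrev Lbl : Type := tm.Λ ⊕ Label

/-- Register reset. [folklore] -/
def reset (v : State tm) : State tm := (v.1, false, false)

/-- The wrapper statements (see the module docstring for the phases). [folklore] -/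
def preStmt : Label → TM2.Stmt (Alph tm) (Lbl tm) (State tm)
  | .read =>
    TM2.Stmt.pop (Sum.inl tm.k₀)
        (fun v (a : Option (tm.Γ tm.k₀)) => (v.1, (a.map e).getD false, v.2.2)) <|
      TM2.Stmt.pop (Sum.inl tm.k₀)
          (fun v (a : Option (tm.Γ tm.k₀)) => (v.1, v.2.1, (a.map e).getD false)) <|
        TM2.Stmt.branch (fun v => decide (v.2.1 = v.2.2))
          (TM2.Stmt.push (Sum.inr ()) (fun v => v.2.1) <|
            TM2.Stmt.load (reset tm) <| TM2.Stmt.goto fun _ => Sum.inr .read)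
          (TM2.Stmt.load (reset tm) <| TM2.Stmt.goto fun _ => Sum.inr .test)
  | .test =>
    TM2.Stmt.pop (Sum.inl tm.k₀)
        (fun v (a : Option (tm.Γ tm.k₀)) => (v.1, (a.map e).getD false, false)) <|
      TM2.Stmt.branch (fun v => v.2.1)
        (TM2.Stmt.load (reset tm) <| TM2.Stmt.goto fun _ => Sum.inr .skip)
        (TM2.Stmt.pop (Sum.inl tm.k₀) (fun v _ => v) <|
          TM2.Stmt.load (reset tm) <| TM2.Stmt.goto fun _ => Sum.inr .restore)
  | .skip =>
    TM2.Stmt.pop (Sum.inl tm.k₀)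
        (fun v (a : Option (tm.Γ tm.k₀)) => (v.1, (a.map e).getD false, false)) <|
      TM2.Stmt.branch (fun v => v.2.1)
        (TM2.Stmt.load (reset tm) <| TM2.Stmt.goto fun _ => Sum.inr .skip)
        (TM2.Stmt.pop (Sum.inl tm.k₀) (fun v _ => v) <|
          TM2.Stmt.pop (Sum.inl tm.k₀)
              (fun v (a : Option (tm.Γ tm.k₀)) => (v.1, (a.map e).getD false, false)) <|
            TM2.Stmt.goto fun _ => Sum.inr .drain)
  | .drain =>
    TM2.Stmt.pop (Sum.inl tm.k₀)
        (fun v (a : Option (tm.Γ tm.k₀)) => (v.1, v.2.1, a.isSome)) <|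
      TM2.Stmt.branch (fun v => v.2.2)
        (TM2.Stmt.load (fun v => (v.1, v.2.1, false)) <| TM2.Stmt.goto fun _ => Sum.inr .drain)
        (TM2.Stmt.goto fun _ => Sum.inr .out)
  | .out =>
    TM2.Stmt.pop (Sum.inr ()) (fun v (a : Option Bool) => (v.1, v.2.1, a.isSome)) <|
      TM2.Stmt.branch (fun v => v.2.2)
        (TM2.Stmt.load (fun v => (v.1, v.2.1, false)) <| TM2.Stmt.goto fun _ => Sum.inr .out)
        (TM2.Stmt.push (Sum.inl tm.k₁) (fun v => (eo.symm v.2.1 : tm.Γ tm.k₁)) <|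
          TM2.Stmt.push (Sum.inl tm.k₁) (fun _ => (eo.symm true : tm.Γ tm.k₁)) <|
            TM2.Stmt.load (reset tm) <| TM2.Stmt.halt)
  | .restore =>
    TM2.Stmt.pop (Sum.inr ()) (fun v (a : Option Bool) => (v.1, a.getD false, a.isSome)) <|
      TM2.Stmt.branch (fun v => v.2.2)
        (TM2.Stmt.push (Sum.inl tm.k₀) (fun v => (e.symm v.2.1 : tm.Γ tm.k₀)) <|
          TM2.Stmt.load (reset tm) <| TM2.Stmt.goto fun _ => Sum.inr .restore)
        (TM2.Stmt.load (reset tm) <| TM2.Stmt.goto fun _ => Sum.inl tm.main)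
  | .tag =>
    TM2.Stmt.push (Sum.inl tm.k₁) (fun _ => (eo.symm false : tm.Γ tm.k₁)) TM2.Stmt.halt

/-- The program of the wrapped machine: translated statements of `tm` (`halt ↦ goto tag`) on the
old labels, wrapper statements on the new labels. [folklore] -/
def prog : Lbl tm → TM2.Stmt (Alph tm) (Lbl tm) (State tm) :=
  Sum.elim (fun l => trStmt₁ (G₂ := AuxΓ) Label.tag (tm.m l)) (preStmt tm e eo)

/-- The wrapped machine `KarpTM.machine tm e eo` (module docstring): it computes the step
function of the one-query oracle algorithm `karpAlg f` when `tm` computes `f`.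
[Ladner–Lynch–Selman 1975, p. 104] [cite: LadnerLynchSelman1975, p. 104 and Prop. 2.1] -/
def machine : FinTM2 where
  K := tm.K ⊕ Unit
  kDecidableEq := inferInstance
  kFin := letI := tm.kFin; inferInstance
  k₀ := Sum.inl tm.k₀
  k₁ := Sum.inl tm.k₁
  Γ := Alph tm
  Λ := Lbl tm
  main := Sum.inr Label.read
  ΛFin := letI := tm.ΛFin; inferInstance
  σ := State tm
  initialState := (tm.initialState, false, false)
  σFin := letI := tm.σFin; inferInstance
  Γk₀Fin := show Fintype (tm.Γ tm.k₀) from tm.Γk₀Fin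
  m := prog tm e eo

/-- The step function of the wrapped machine, with the canonical instances. [folklore] -/
theorem machine_step (c : (machine tm e eo).Cfg) :
    (machine tm e eo).step c = TM2.step (prog tm e eo) c := rfl

/-! ### Stack bookkeeping -/

/-- Extend a stack assignment of `tm` by the content `a` of the auxiliary stack. [folklore] -/
def bigStk (S : ∀ k, List (tm.Γ k)) (a : List Bool) : ∀ j : tm.K ⊕ Unit, List (Alph tm j)
  | Sum.inl k => S k
  | Sum.inr _ => a

/-- The old stacks of an extended stack assignment. [folklore] -/
@[simp] theorem bigStk_inl (S : ∀ k, List (tm.Γ k)) (a : List Bool) (k : tm.K) :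
    bigStk tm S a (Sum.inl k) = S k := rfl

/-- The auxiliary stack of an extended stack assignment. [folklore] -/
@[simp] theorem bigStk_inr (S : ∀ k, List (tm.Γ k)) (a : List Bool) (u : Unit) :
    bigStk tm S a (Sum.inr u) = a := rfl

/-- Updating an old stack commutes with the extension. [folklore] -/
theorem update_bigStk_inl (S : ∀ k, List (tm.Γ k)) (a : List Bool) (k : tm.K)
    (L : List (tm.Γ k)) :
    update (bigStk tm S a) (Sum.inl k) L = bigStk tm (update S k L) a := by
  funext j
  rcases j with k' | u
  · by_cases h : k' = k
    · subst h; simp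
    · rw [update_of_ne (by simpa using h), bigStk_inl, bigStk_inl, update_of_ne h]
  · rw [update_of_ne (by simp)]; rfl

/-- Updating the auxiliary stack of an extension. [folklore] -/
theorem update_bigStk_inr (S : ∀ k, List (tm.Γ k)) (a L : List Bool) (u : Unit) :
    update (bigStk tm S a) (Sum.inr u) L = bigStk tm S L := by
  funext j
  rcases j with k' | u'
  · rw [update_of_ne (by simp)]; rfl
  · cases u; cases u'; simp

/-- With empty auxiliary stack the extension is `TM2Comp.stk₁`. [folklore] -/
theorem bigStk_nil (S : ∀ k, List (tm.Γ k)) : bigStk tm S [] = stk₁ (G₂ := AuxΓ) S := by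
  funext j
  rcases j with k | u <;> rfl

/-- Stacks during the wrapper phases: input stack `s`, auxiliary stack `a`, all others empty.
[folklore] -/
def preStk (s : List (tm.Γ tm.k₀)) (a : List Bool) : ∀ j : tm.K ⊕ Unit, List (Alph tm j) :=
  bigStk tm (update (fun _ => []) tm.k₀ s) a

/-- The input stack during the wrapper phases. [folklore] -/
@[simp] theorem preStk_in (s : List (tm.Γ tm.k₀)) (a : List Bool) :
    preStk tm s a (Sum.inl tm.k₀) = s := by
  simp [preStk]

/-- The auxiliary stack during the wrapper phases. [folklore] -/
@[simp] theorem preStk_aux (s : List (tm.Γ tm.k₀)) (a : List Bool) (u : Unit) :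
    preStk tm s a (Sum.inr u) = a := rfl

/-- Writing the input stack during the wrapper phases. [folklore] -/
@[simp] theorem update_preStk_in (s s' : List (tm.Γ tm.k₀)) (a : List Bool) :
    update (preStk tm s a) (Sum.inl tm.k₀) s' = preStk tm s' a := by
  rw [preStk, update_bigStk_inl, update_idem]; rfl

/-- Writing the auxiliary stack during the wrapper phases. [folklore] -/
@[simp] theorem update_preStk_aux (s : List (tm.Γ tm.k₀)) (a a' : List Bool) (u : Unit) :
    update (preStk tm s a) (Sum.inr u) a' = preStk tm s a' :=
  update_bigStk_inr tm _ a a' u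

/-- The initial configuration of the wrapped machine. [folklore] -/
theorem initList_machine (s : List (tm.Γ tm.k₀)) :
    initList (machine tm e eo) s =
      ⟨some (Sum.inr .read), (tm.initialState, false, false), preStk tm s []⟩ := by
  rw [initList_eq]
  refine TM2.Cfg.mk.injEq _ _ _ _ _ _ |>.mpr ⟨rfl, rfl, ?_⟩
  rw [preStk, bigStk_nil, stk₁_update_bot]
  rfl

/-! ### Simulation of `tm` inside the wrapped machine -/

/-- Embed a configuration of `tm` into the wrapped machine (auxiliary stack empty, registers
cleared, halting label sent to `tag`); this is `TM2Comp.cfg₁`. [folklore] -/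
def liftCfg (c : tm.Cfg) : (machine tm e eo).Cfg :=
  cfg₁ (G₂ := AuxΓ) Label.tag ((false, false) : Bool × Bool) c

/-- One step of `tm` is one step of the wrapped machine on embedded configurations. [folklore] -/
theorem step_liftCfg (c d : tm.Cfg) (h : tm.step c = some d) :
    (machine tm e eo).step (liftCfg tm e eo c) = some (liftCfg tm e eo d) := by
  obtain ⟨_ | l, v, S⟩ := c
  · simp [FinTM2.step, TM2.step] at h
  · simp only [FinTM2.step, TM2.step] at h
    obtain rfl := Option.some.inj h
    rw [machine_step]
    simp only [liftCfg, cfg₁, Option.elim, TM2.step, prog, Sum.elim_inl]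
    rw [stepAux_trStmt₁]
    rfl

/-- Iterated steps of `tm` are iterated steps of the wrapped machine. [folklore] -/
theorem iterate_liftCfg {n : ℕ} {c d : tm.Cfg} (h : (flip bind tm.step)^[n] (some c) = some d) :
    (flip bind (machine tm e eo).step)^[n] (some (liftCfg tm e eo c)) =
      some (liftCfg tm e eo d) :=
  iterate_bind_map tm.step (machine tm e eo).step (liftCfg tm e eo) (step_liftCfg tm e eo) n c d h

/-- The embedded initial configuration of `tm`. [folklore] -/
theorem liftCfg_initList (s : List (tm.Γ tm.k₀)) :
    liftCfg tm e eo (initList tm s) =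
      ⟨some (Sum.inl tm.main), (tm.initialState, false, false), preStk tm s []⟩ := by
  rw [initList_eq]
  simp only [liftCfg, cfg₁, Option.elim]
  refine TM2.Cfg.mk.injEq _ _ _ _ _ _ |>.mpr ⟨rfl, rfl, ?_⟩
  rw [preStk, bigStk_nil]

/-- The `tag` phase: from the embedded halting configuration of `tm` with output `s`, one step
pushes the tag bit `false` and halts with output `false :: s`. [folklore] -/
theorem step_liftCfg_haltList (s : List (tm.Γ tm.k₁)) :
    (machine tm e eo).step (liftCfg tm e eo (haltList tm s)) =
      some (haltList (machine tm e eo) (eo.symm false :: s)) := by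
  rw [haltList_eq, haltList_eq, machine_step]
  simp only [liftCfg, cfg₁, Option.elim, TM2.step, prog, Sum.elim_inr, preStmt, TM2.stepAux]
  refine congrArg some (TM2.Cfg.mk.injEq _ _ _ _ _ _ |>.mpr ⟨rfl, rfl, ?_⟩)
  change update (stk₁ (G₂ := AuxΓ) (update (fun k => ([] : List (tm.Γ k))) tm.k₁ s))
      (Sum.inl tm.k₁)
      (eo.symm false :: update (fun k => ([] : List (tm.Γ k))) tm.k₁ s tm.k₁) =
    update (fun j => ([] : List (Alph tm j))) (Sum.inl tm.k₁) (eo.symm false :: s)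
  rw [update_self, stk₁_update, update_idem, stk₁_update_bot]

/-! ### The wrapper phases -/

section Phases

/-- Configuration in phase `read`: remaining input `w`, auxiliary stack `a`. [folklore] -/
def readCfg (w a : List Bool) : (machine tm e eo).Cfg :=
  ⟨some (Sum.inr .read), (tm.initialState, false, false), preStk tm (w.map e.symm) a⟩

/-- Configuration in phase `test`. [folklore] -/
def testCfg (w a : List Bool) : (machine tm e eo).Cfg :=
  ⟨some (Sum.inr .test), (tm.initialState, false, false), preStk tm (w.map e.symm) a⟩

/-- Configuration in phase `skip`. [folklore] -/
def skipCfg (w a : List Bool) : (machine tm e eo).Cfg :=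
  ⟨some (Sum.inr .skip), (tm.initialState, false, false), preStk tm (w.map e.symm) a⟩

/-- Configuration in phase `drain`, answer bit `b` in the first register. [folklore] -/
def drainCfg (b : Bool) (w a : List Bool) : (machine tm e eo).Cfg :=
  ⟨some (Sum.inr .drain), (tm.initialState, b, false), preStk tm (w.map e.symm) a⟩

/-- Configuration in phase `out`, answer bit `b` in the first register, input stack empty.
[folklore] -/
def outCfg (b : Bool) (a : List Bool) : (machine tm e eo).Cfg :=
  ⟨some (Sum.inr .out), (tm.initialState, b, false), preStk tm [] a⟩

/-- Configuration in phase `restore`: auxiliary stack `a`, input stack `u`. [folklore] -/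
def restoreCfg (a u : List Bool) : (machine tm e eo).Cfg :=
  ⟨some (Sum.inr .restore), (tm.initialState, false, false), preStk tm (u.map e.symm) a⟩

/-- `read` on a doubled pair `bb`: push `b` on the auxiliary stack. [folklore] -/
theorem step_readCfg_cons_cons_self (b : Bool) (rest a : List Bool) :
    (machine tm e eo).step (readCfg tm e eo (b :: b :: rest) a) =
      some (readCfg tm e eo rest (b :: a)) := by
  rw [machine_step]
  simp only [readCfg, TM2.step, prog, Sum.elim_inr, preStmt, TM2.stepAux, preStk_in,
    List.map_cons, List.head?_cons, Option.map_some, Equiv.apply_symm_apply, Option.getD_some,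
    List.tail_cons, update_preStk_in, decide_true, cond_true, preStk_aux, update_preStk_aux,
    reset]
  rfl

/-- `read` on the separator `01`: switch to `test`. [folklore] -/
theorem step_readCfg_sep (rest a : List Bool) :
    (machine tm e eo).step (readCfg tm e eo (false :: true :: rest) a) =
      some (testCfg tm e eo rest a) := by
  rw [machine_step]
  simp only [readCfg, TM2.step, prog, Sum.elim_inr, preStmt, TM2.stepAux, preStk_in,
    List.map_cons, List.head?_cons, Option.map_some, Equiv.apply_symm_apply, Option.getD_some,
    List.tail_cons, update_preStk_in, reset, testCfg]
  rfl

/-- The `read` phase un-doubles `x` (reversed) onto the auxiliary stack and stops after the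
separator, in `|x| + 1` steps. [folklore] -/
theorem iterate_readCfg :
    ∀ x rest a : List Bool,
      (flip bind (machine tm e eo).step)^[x.length + 1]
          (some (readCfg tm e eo (boolPair x rest) a)) =
        some (testCfg tm e eo rest (x.reverse ++ a))
  | [], rest, a => by
    simp only [List.length_nil, Nat.zero_add, iterate_one, List.reverse_nil, List.nil_append]
    exact step_readCfg_sep tm e eo rest a
  | b :: x, rest, a => by
    rw [List.length_cons, iterate_succ_apply]
    change (flip bind (machine tm e eo).step)^[x.length + 1]
      ((machine tm e eo).step (readCfg tm e eo (b :: b :: boolPair x rest) a)) = _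
    rw [step_readCfg_cons_cons_self, iterate_readCfg x rest (b :: a)]
    simp

/-- `test` on a non-empty transcript (leading `1` of the unary length field): switch to `skip`.
[folklore] -/
theorem step_testCfg_true (rest a : List Bool) :
    (machine tm e eo).step (testCfg tm e eo (true :: rest) a) =
      some (skipCfg tm e eo rest a) := by
  rw [machine_step]
  simp only [testCfg, TM2.step, prog, Sum.elim_inr, preStmt, TM2.stepAux, preStk_in,
    List.map_cons, List.head?_cons, Option.map_some, Equiv.apply_symm_apply, Option.getD_some,
    List.tail_cons, update_preStk_in, cond_true, reset, skipCfg]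
  rfl

/-- `test` on the empty transcript (`listBool.encode [] = 01`): discard the field and switch to
`restore`. [folklore] -/
theorem step_testCfg_nil (a : List Bool) :
    (machine tm e eo).step (testCfg tm e eo [false, true] a) =
      some (restoreCfg tm e eo a []) := by
  rw [machine_step]
  simp only [testCfg, TM2.step, prog, Sum.elim_inr, preStmt, TM2.stepAux, preStk_in,
    List.map_cons, List.map_nil, List.head?_cons, Option.map_some, Equiv.apply_symm_apply,
    Option.getD_some, List.tail_cons, update_preStk_in, cond_false, reset, restoreCfg]
  rfl

/-- `skip` on a `1` of the unary length field: pop it. [folklore] -/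
theorem step_skipCfg_true (rest a : List Bool) :
    (machine tm e eo).step (skipCfg tm e eo (true :: rest) a) =
      some (skipCfg tm e eo rest a) := by
  rw [machine_step]
  simp only [skipCfg, TM2.step, prog, Sum.elim_inr, preStmt, TM2.stepAux, preStk_in,
    List.map_cons, List.head?_cons, Option.map_some, Equiv.apply_symm_apply, Option.getD_some,
    List.tail_cons, update_preStk_in, cond_true, reset]
  rfl

/-- `skip` at the separator of the length field: discard it, read the answer bit `c`, switch to
`drain`. [folklore] -/
theorem step_skipCfg_sep (c : Bool) (rest a : List Bool) :
    (machine tm e eo).step (skipCfg tm e eo (false :: true :: c :: rest) a) =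
      some (drainCfg tm e eo c rest a) := by
  rw [machine_step]
  simp only [skipCfg, TM2.step, prog, Sum.elim_inr, preStmt, TM2.stepAux, preStk_in,
    List.map_cons, List.head?_cons, Option.map_some, Equiv.apply_symm_apply, Option.getD_some,
    List.tail_cons, update_preStk_in, cond_false, drainCfg]
  rfl

/-- The `skip` phase: `j` further `1`s, the separator and the answer bit, in `j + 1` steps.
[folklore] -/
theorem iterate_skipCfg (c : Bool) (rest a : List Bool) :
    ∀ j : ℕ,
      (flip bind (machine tm e eo).step)^[j + 1]
          (some (skipCfg tm e eo (List.replicate j true ++ false :: true :: c :: rest) a)) =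
        some (drainCfg tm e eo c rest a)
  | 0 => by
    simp only [Nat.zero_add, iterate_one, List.replicate_zero, List.nil_append]
    exact step_skipCfg_sep tm e eo c rest a
  | j + 1 => by
    rw [iterate_succ_apply]
    change (flip bind (machine tm e eo).step)^[j + 1]
      ((machine tm e eo).step
        (skipCfg tm e eo (true :: (List.replicate j true ++ false :: true :: c :: rest)) a)) = _
    rw [step_skipCfg_true]
    exact iterate_skipCfg c rest a j

/-- `drain` pops one input symbol. [folklore] -/
theorem step_drainCfg_cons (c b : Bool) (w a : List Bool) :
    (machine tm e eo).step (drainCfg tm e eo c (b :: w) a) =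
      some (drainCfg tm e eo c w a) := by
  rw [machine_step]
  simp only [drainCfg, TM2.step, prog, Sum.elim_inr, preStmt, TM2.stepAux, preStk_in,
    List.map_cons, List.head?_cons, Option.isSome_some, cond_true, List.tail_cons,
    update_preStk_in]
  rfl

/-- `drain` on empty input: switch to `out`. [folklore] -/
theorem step_drainCfg_nil (c : Bool) (a : List Bool) :
    (machine tm e eo).step (drainCfg tm e eo c [] a) = some (outCfg tm e eo c a) := by
  rw [machine_step]
  simp only [drainCfg, TM2.step, prog, Sum.elim_inr, preStmt, TM2.stepAux, preStk_in,
    List.map_nil, List.head?_nil, Option.isSome_none, cond_false, List.tail_nil,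
    update_preStk_in, outCfg]
  rfl

/-- The `drain` phase empties the input stack in `|w| + 1` steps. [folklore] -/
theorem iterate_drainCfg (c : Bool) (a : List Bool) :
    ∀ w : List Bool,
      (flip bind (machine tm e eo).step)^[w.length + 1] (some (drainCfg tm e eo c w a)) =
        some (outCfg tm e eo c a)
  | [] => by
    simp only [List.length_nil, Nat.zero_add, iterate_one]
    exact step_drainCfg_nil tm e eo c a
  | b :: w => by
    rw [List.length_cons, iterate_succ_apply]
    change (flip bind (machine tm e eo).step)^[w.length + 1]
      ((machine tm e eo).step (drainCfg tm e eo c (b :: w) a)) = _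
    rw [step_drainCfg_cons]
    exact iterate_drainCfg c a w

/-- `out` pops one auxiliary symbol. [folklore] -/
theorem step_outCfg_cons (c b : Bool) (a : List Bool) :
    (machine tm e eo).step (outCfg tm e eo c (b :: a)) = some (outCfg tm e eo c a) := by
  rw [machine_step]
  simp only [outCfg, TM2.step, prog, Sum.elim_inr, preStmt, TM2.stepAux, preStk_aux,
    List.head?_cons, Option.isSome_some, cond_true, List.tail_cons, update_preStk_aux]
  rfl

/-- `out` on empty auxiliary stack: output `[true, c]` and halt. [folklore] -/
theorem step_outCfg_nil (c : Bool) :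
    (machine tm e eo).step (outCfg tm e eo c []) =
      some (haltList (machine tm e eo) [eo.symm true, eo.symm c]) := by
  rw [machine_step, haltList_eq]
  simp only [outCfg, TM2.step, prog, Sum.elim_inr, preStmt, TM2.stepAux, preStk_aux,
    List.head?_nil, Option.isSome_none, cond_false, List.tail_nil, update_preStk_aux, reset]
  refine congrArg some (TM2.Cfg.mk.injEq _ _ _ _ _ _ |>.mpr ⟨rfl, rfl, ?_⟩)
  have h0 : preStk tm ([] : List (tm.Γ tm.k₀)) [] = fun _ => [] := by
    rw [preStk, update_eq_self, bigStk_nil]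
    funext j; rcases j with k | u <;> rfl
  rw [h0]
  change update (update (fun j => ([] : List (Alph tm j))) (Sum.inl tm.k₁) [eo.symm c])
      (Sum.inl tm.k₁) (eo.symm true ::
        update (fun j => ([] : List (Alph tm j))) (Sum.inl tm.k₁) [eo.symm c] (Sum.inl tm.k₁)) =
    update (fun j => ([] : List (Alph tm j))) (Sum.inl tm.k₁) [eo.symm true, eo.symm c]
  rw [update_self, update_idem]

/-- The `out` phase discards the auxiliary stack and halts with output `[true, c]`, in `|a| + 1`
steps. [folklore] -/
theorem iterate_outCfg (c : Bool) :
    ∀ a : List Bool,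
      (flip bind (machine tm e eo).step)^[a.length + 1] (some (outCfg tm e eo c a)) =
        some (haltList (machine tm e eo) [eo.symm true, eo.symm c])
  | [] => by
    simp only [List.length_nil, Nat.zero_add, iterate_one]
    exact step_outCfg_nil tm e eo c
  | b :: a => by
    rw [List.length_cons, iterate_succ_apply]
    change (flip bind (machine tm e eo).step)^[a.length + 1]
      ((machine tm e eo).step (outCfg tm e eo c (b :: a))) = _
    rw [step_outCfg_cons]
    exact iterate_outCfg c a

/-- `restore` moves one symbol from the auxiliary stack to the input stack. [folklore] -/
theorem step_restoreCfg_cons (b : Bool) (a u : List Bool) :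
    (machine tm e eo).step (restoreCfg tm e eo (b :: a) u) =
      some (restoreCfg tm e eo a (b :: u)) := by
  rw [machine_step]
  simp only [restoreCfg, TM2.step, prog, Sum.elim_inr, preStmt, TM2.stepAux, preStk_aux,
    List.head?_cons, Option.isSome_some, cond_true, List.tail_cons, Option.getD_some,
    update_preStk_aux, preStk_in, update_preStk_in, reset, List.map_cons]
  rfl

/-- `restore` on empty auxiliary stack: enter `tm` at its main label. [folklore] -/
theorem step_restoreCfg_nil (u : List Bool) :
    (machine tm e eo).step (restoreCfg tm e eo [] u) =
      some (liftCfg tm e eo (initList tm (u.map e.symm))) := by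
  rw [machine_step, liftCfg_initList]
  simp only [restoreCfg, TM2.step, prog, Sum.elim_inr, preStmt, TM2.stepAux, preStk_aux,
    List.head?_nil, Option.isSome_none, cond_false, List.tail_nil, update_preStk_aux, reset]
  rfl

/-- The `restore` phase moves the auxiliary stack back (restoring the order) and enters `tm`,
in `|a| + 1` steps. [folklore] -/
theorem iterate_restoreCfg :
    ∀ a u : List Bool,
      (flip bind (machine tm e eo).step)^[a.length + 1] (some (restoreCfg tm e eo a u)) =
        some (liftCfg tm e eo (initList tm ((a.reverse ++ u).map e.symm)))
  | [], u => by
    simp only [List.length_nil, Nat.zero_add, iterate_one, List.reverse_nil, List.nil_append]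
    exact step_restoreCfg_nil tm e eo u
  | b :: a, u => by
    rw [List.length_cons, iterate_succ_apply]
    change (flip bind (machine tm e eo).step)^[a.length + 1]
      ((machine tm e eo).step (restoreCfg tm e eo (b :: a) u)) = _
    rw [step_restoreCfg_cons, iterate_restoreCfg a (b :: u)]
    simp

end Phases

/-! ### The two runs of the wrapped machine -/

/-- Chaining two iterated runs. [folklore] -/
private theorem iterate_chain {σ : Type} (F : Option σ → Option σ) {a b c : Option σ} {m n : ℕ}
    (h₁ : F^[m] a = b) (h₂ : F^[n] b = c) : F^[n + m] a = c := by
  rw [iterate_add_apply, h₁, h₂]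

/-- **Query run.** On the encoded pair `boolPair x (listBool.encode []) = boolPair x [0,1]`
(empty transcript), if `tm` maps `x` to the output word `s` in `n` steps then the wrapped
machine halts with output `false :: s` in `n + (2|x| + 4)` steps.
[Ladner–Lynch–Selman 1975, p. 104] [cite: LadnerLynchSelman1975, p. 104 and Prop. 2.1] -/
theorem iterate_query (x : List Bool) {s : List (tm.Γ tm.k₁)} {n : ℕ}
    (h : (flip bind tm.step)^[n] (some (initList tm (x.map e.symm))) = some (haltList tm s)) :
    (flip bind (machine tm e eo).step)^[n + (2 * x.length + 4)]
        (some (initList (machine tm e eo) ((boolPair x [false, true]).map e.symm))) =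
      some (haltList (machine tm e eo) (eo.symm false :: s)) := by
  have h0 : initList (machine tm e eo) ((boolPair x [false, true]).map e.symm) =
      readCfg tm e eo (boolPair x [false, true]) [] := initList_machine tm e eo _
  have h1 := iterate_readCfg tm e eo x [false, true] []
  have h2 : (flip bind (machine tm e eo).step)^[1]
      (some (testCfg tm e eo [false, true] (x.reverse ++ []))) =
        some (restoreCfg tm e eo x.reverse []) := by
    rw [List.append_nil, iterate_one]
    exact step_testCfg_nil tm e eo _
  have h3 : (flip bind (machine tm e eo).step)^[x.reverse.length + 1]
      (some (restoreCfg tm e eo x.reverse [])) =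
        some (liftCfg tm e eo (initList tm (x.map e.symm))) := by
    have := iterate_restoreCfg tm e eo x.reverse []
    rwa [List.reverse_reverse, List.append_nil] at this
  have h4 := iterate_liftCfg tm e eo h
  have h5 : (flip bind (machine tm e eo).step)^[1] (some (liftCfg tm e eo (haltList tm s))) =
      some (haltList (machine tm e eo) (eo.symm false :: s)) := by
    rw [iterate_one]
    exact step_liftCfg_haltList tm e eo s
  have H := iterate_chain _ (iterate_chain _ (iterate_chain _ (iterate_chain _ h1 h2) h3) h4) h5
  have hsplit : n + (2 * x.length + 4) =
      1 + (n + ((x.reverse.length + 1) + (1 + (x.length + 1)))) := by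
    simp only [List.length_reverse]; omega
  rw [h0, hsplit]
  exact H

/-- **Answer run.** On an encoded pair with non-empty transcript, i.e. on
`boolPair x (1^(j+1) ++ 0 1 c₀ c')` (`1^(j+1)` the rest of the doubled unary length field, `c₀`
the first bit after its separator), the wrapped machine halts with output `[true, c₀]` in
`2|x| + j + |c'| + 5` steps. [Ladner–Lynch–Selman 1975, p. 104]
[cite: LadnerLynchSelman1975, p. 104 and Prop. 2.1] -/
theorem iterate_answer (x : List Bool) (j : ℕ) (c₀ : Bool) (c' : List Bool) :
    (flip bind (machine tm e eo).step)^[(x.length + 1) + ((c'.length + 1) + ((j + 1) +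
        (1 + (x.length + 1))))]
        (some (initList (machine tm e eo)
          ((boolPair x (true :: (List.replicate j true ++ false :: true :: c₀ :: c'))).map
            e.symm))) =
      some (haltList (machine tm e eo) [eo.symm true, eo.symm c₀]) := by
  rw [initList_machine]
  have h1 := iterate_readCfg tm e eo x
    (true :: (List.replicate j true ++ false :: true :: c₀ :: c')) []
  have h2 : (flip bind (machine tm e eo).step)^[1]
      (some (testCfg tm e eo (true :: (List.replicate j true ++ false :: true :: c₀ :: c'))
        (x.reverse ++ []))) =
      some (skipCfg tm e eo (List.replicate j true ++ false :: true :: c₀ :: c') x.reverse) := by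
    rw [List.append_nil, iterate_one]
    exact step_testCfg_true tm e eo _ _
  have h3 := iterate_skipCfg tm e eo c₀ c' x.reverse j
  have h4 := iterate_drainCfg tm e eo c₀ x.reverse c'
  have h5 := iterate_outCfg tm e eo c₀ x.reverse
  have H := iterate_chain _ (iterate_chain _ (iterate_chain _ (iterate_chain _ h1 h2) h3) h4) h5
  rw [List.length_reverse] at H
  exact H

end Literature.Computability.Complexity.KarpTM

/-! ### Encodings of the transcript -/

namespace Literature.Computability.Complexity

open _root_.Computability Turing StateTransition Polynomial

/-- The doubled unary length field: `boolPair (unaryEncodeNat m) body = 1^(2m) ++ 0 1 body`.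
[Arora–Barak 2009, §0.1] [cite: AroraBarak2009, §0.1] -/
theorem boolPair_unaryEncodeNat (m : ℕ) (body : List Bool) :
    boolPair (unaryEncodeNat m) body = List.replicate (2 * m) true ++ false :: true :: body := by
  induction m with
  | zero => simp [boolPair, unaryEncodeNat]
  | succ m ih =>
    have h : boolPair (unaryEncodeNat (m + 1)) body = true :: true :: boolPair (unaryEncodeNat m)
        body := by simp [boolPair, unaryEncodeNat]
    rw [h, ih, Nat.mul_succ, List.replicate_succ, List.replicate_succ]
    rfl

/-- The first bit of `boolPair a t` is `a.headD false` (the separator starts with `0`).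
[Arora–Barak 2009, §0.1] [cite: AroraBarak2009, §0.1] -/
theorem boolPair_eq_headD_cons (a t : List Bool) :
    ∃ c' : List Bool,
      boolPair a t = a.headD false :: c' ∧ c'.length + 1 = (boolPair a t).length := by
  rcases a with _ | ⟨b, a⟩
  · exact ⟨true :: t, by simp [boolPair], by simp [boolPair]⟩
  · exact ⟨b :: boolPair a t, by simp [boolPair], by
      simp only [List.length_cons, length_boolPair]; omega⟩

/-- The `listBool` code of the empty transcript is `01`. [H21 design C2] [folklore] -/
theorem listBool_encode_nil :
    (encodingList Bool).listBool.encode ([] : List (List Bool)) = [false, true] := rfl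

/-- The `listBool` code of a non-empty transcript `a :: as`:
`boolPair (1 :: unary |as|) (boolPair a t)` for the code `t` of the tail. [H21 design C2]
[folklore] -/
theorem listBool_encode_cons (a : List Bool) (as : List (List Bool)) :
    ∃ t : List Bool, (encodingList Bool).listBool.encode (a :: as) =
      boolPair (true :: unaryEncodeNat as.length) (boolPair a t) :=
  ⟨_, rfl⟩

/-! ### The one-query oracle algorithm of a many-one reduction -/

/-- The reduction procedure of a many-one reduction `f` as an oracle algorithm: on the empty
transcript ask the single query `f x`; on a non-empty transcript output the first bit of the
first answer (the answer of a language oracle is the one-bit string `[x ∈ B]`).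
[Ladner–Lynch–Selman 1975, p. 104: "a many-one reduction procedure entails exactly one
membership question of the oracle"] [cite: LadnerLynchSelman1975, p. 104 and Prop. 2.1] -/
def karpAlg (f : List Bool → List Bool) : OracleAlg Bool where
  step x answers :=
    match answers with
    | [] => Sum.inl (f x)
    | a :: _ => Sum.inr (a.headD false)

/-- The run of `karpAlg f`: within any budget `≥ 2` it outputs the first bit of the oracle's
answer to `f x`. [Ladner–Lynch–Selman 1975, p. 104]
[cite: LadnerLynchSelman1975, p. 104 and Prop. 2.1] -/
theorem run_karpAlg (f : List Bool → List Bool) (O : Oracle) (k : ℕ) (x : List Bool) :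
    (karpAlg f).run O (k + 2) x = some ((O (f x)).headD false) := by
  simp [OracleAlg.run, OracleAlg.runAux, karpAlg]

/-- The transcript of `karpAlg f`: within any budget `≥ 2` the single query `f x`.
[Ladner–Lynch–Selman 1975, p. 104] [cite: LadnerLynchSelman1975, p. 104 and Prop. 2.1] -/
theorem queries_karpAlg (f : List Bool → List Bool) (O : Oracle) (k : ℕ) (x : List Bool) :
    (karpAlg f).queries O (k + 2) x = [f x] := by
  simp [OracleAlg.queries, OracleAlg.queriesAux, karpAlg]

/-- The wrapped bundled machine `karpLift M` (input and output alphabet `Bool` via the old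
identifications): it computes the step function of `karpAlg f` when `M` computes `f`.
[Ladner–Lynch–Selman 1975, p. 104] [cite: LadnerLynchSelman1975, p. 104 and Prop. 2.1] -/
def karpLift (M : TM2ComputableAux Bool Bool) : TM2ComputableAux Bool Bool where
  tm := KarpTM.machine M.tm M.inputAlphabet M.outputAlphabet
  inputAlphabet := show M.tm.Γ M.tm.k₀ ≃ Bool from M.inputAlphabet
  outputAlphabet := show M.tm.Γ M.tm.k₁ ≃ Bool from M.outputAlphabet

/-- Query case of the wrapped machine, bundled: if `M` maps `x` to `y` within `m` steps then
`karpLift M` maps `boolPair x [0,1]` to `false :: y` within `m + (2|x| + 4)` steps.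
[Ladner–Lynch–Selman 1975, p. 104] [cite: LadnerLynchSelman1975, p. 104 and Prop. 2.1] -/
theorem outputsWithin_karpLift_query (M : TM2ComputableAux Bool Bool) {x y : List Bool} {m : ℕ}
    (h : M.OutputsWithin x y m) :
    (karpLift M).OutputsWithin (boolPair x [false, true]) (false :: y)
      (m + (2 * x.length + 4)) := by
  obtain ⟨⟨⟨n, hn⟩, hle⟩⟩ := h
  refine ⟨⟨⟨n + (2 * x.length + 4), ?_⟩, Nat.add_le_add_right hle _⟩⟩
  exact KarpTM.iterate_query M.tm M.inputAlphabet M.outputAlphabet x hn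

/-- Answer case of the wrapped machine, bundled: on `boolPair x (listBool.encode (a :: as))`
the machine `karpLift M` outputs `[true, a.headD false]` within `|w|` steps (`w` the input).
[Ladner–Lynch–Selman 1975, p. 104] [cite: LadnerLynchSelman1975, p. 104 and Prop. 2.1] -/
theorem outputsWithin_karpLift_answer (M : TM2ComputableAux Bool Bool) (x a : List Bool)
    (as : List (List Bool)) :
    (karpLift M).OutputsWithin (boolPair x ((encodingList Bool).listBool.encode (a :: as)))
      [true, a.headD false]
      (boolPair x ((encodingList Bool).listBool.encode (a :: as))).length := by
  obtain ⟨t, ht⟩ := listBool_encode_cons a as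
  obtain ⟨c', hc', hlen⟩ := boolPair_eq_headD_cons a t
  have hw : boolPair x ((encodingList Bool).listBool.encode (a :: as)) =
      boolPair x (true :: (List.replicate (2 * as.length + 1) true ++
        false :: true :: a.headD false :: c')) := by
    rw [ht, ← hc']
    have : boolPair (true :: unaryEncodeNat as.length) (boolPair a t) =
        true :: true :: boolPair (unaryEncodeNat as.length) (boolPair a t) := by simp [boolPair]
    rw [this, boolPair_unaryEncodeNat, List.replicate_succ]
    rfl
  rw [hw]
  refine ⟨⟨⟨(x.length + 1) + ((c'.length + 1) + (((2 * as.length + 1) + 1) +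
    (1 + (x.length + 1)))), ?_⟩, ?_⟩⟩
  · exact KarpTM.iterate_answer M.tm M.inputAlphabet M.outputAlphabet x _ _ c'
  · change (x.length + 1) + ((c'.length + 1) + (((2 * as.length + 1) + 1) +
      (1 + (x.length + 1)))) ≤ _
    simp only [length_boolPair, List.length_cons, List.length_append, List.length_replicate]
    omega

/-- **The step function of the one-query algorithm is polynomial-time.** If `f` is computed by
`M` in time `p`, then the step function of `karpAlg f` (on the `boolPair`-encoded pair of input
and transcript, output tagged by `sumBool`) is computed by `karpLift M` in time `n + p n`.
[Ladner–Lynch–Selman 1975, p. 104 and Prop. 2.1]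
[cite: LadnerLynchSelman1975, p. 104 and Prop. 2.1] -/
theorem isPolyTime_karpAlg {f : List Bool → List Bool}
    (hf : PolyTimeComputable (id : List Bool → List Bool) id f) :
    (karpAlg f).IsPolyTime encodingBoolBool := by
  obtain ⟨p, M, hM⟩ := hf
  refine ⟨X + p, karpLift M, ?_⟩
  rintro ⟨x, _ | ⟨a, as⟩⟩
  · -- empty transcript: the query `f x`
    change (karpLift M).OutputsWithin (boolPair x ((encodingList Bool).listBool.encode []))
      (false :: f x) ((X + p).eval (boolPair x ((encodingList Bool).listBool.encode [])).length)
    rw [listBool_encode_nil]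
    refine (outputsWithin_karpLift_query M (hM x)).mono ?_
    simp only [eval_add, eval_X, length_boolPair, List.length_cons, List.length_nil, id]
    -- evaluation of an `ℕ`-polynomial is monotone in the argument (as in `comp_holds`;
    -- cf. `Literature.Computability.Complexity.natPoly_eval_mono` in `CircuitLowerBounds.lean`, not imported here)
    have hmono : ∀ (q : Polynomial ℕ) {a b : ℕ}, a ≤ b → q.eval a ≤ q.eval b := by
      intro q a b hab
      induction q using Polynomial.induction_on' with
      | add p q hp hq => simp only [eval_add]; exact Nat.add_le_add hp hq
      | monomial n c =>
        simp only [eval_monomial]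
        exact Nat.mul_le_mul_left c (Nat.pow_le_pow_left hab n)
    have := hmono p (show x.length ≤ 2 * x.length + 2 + (0 + 1 + 1) by omega)
    omega
  · -- non-empty transcript: the answer bit
    change (karpLift M).OutputsWithin (boolPair x ((encodingList Bool).listBool.encode (a :: as)))
      [true, a.headD false]
      ((X + p).eval (boolPair x ((encodingList Bool).listBool.encode (a :: as))).length)
    refine (outputsWithin_karpLift_answer M x a as).mono ?_
    simp only [eval_add, eval_X]
    omega

/-! ### Discharge of the named facts -/

open scoped Notation

/-- **Karp reducibility implies Cook reducibility** (`L₁ ≤ₚ L₂ → L₁ ≤ᵀₚ L₂`), discharge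
of the named fact `PolyTimeKarpReducible.turing`: given the polynomial-time reduction `f`
(machine `M`, time `p`), the oracle algorithm `karpAlg f` asks the single query `f x` (of
length `≤ |x| + D p(|x|)`, `D` the push bound of `M`) and outputs the oracle's answer bit
`[f x ∈ L₂] = [x ∈ L₁]`; its step function is polynomial-time (`isPolyTime_karpAlg`); the
round and query budget is `q = X + D p + 2`. [Ladner–Lynch–Selman 1975, p. 104 ("a many-one
reduction procedure entails exactly one membership question of the oracle") and §2, Prop. 2.1]
[cite: LadnerLynchSelman1975, p. 104 and Prop. 2.1] -/
theorem PolyTimeKarpReducible.turing_holds : PolyTimeKarpReducible.turing := by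
  intro L₁ L₂ h
  obtain ⟨f, hf, hL⟩ := h
  obtain ⟨p, M, hM⟩ := id hf
  refine ⟨karpAlg f, isPolyTime_karpAlg hf, X + C (TM2Comp.machinePushBound M.tm) * p + 2,
    fun x => ?_⟩
  have hq : (X + C (TM2Comp.machinePushBound M.tm) * p + 2 : Polynomial ℕ).eval x.length =
      (x.length + TM2Comp.machinePushBound M.tm * p.eval x.length) + 2 := by
    simp [eval_add, eval_mul, eval_X]
  rw [hq, run_karpAlg, queries_karpAlg]
  refine ⟨?_, ?_⟩
  · simp only [Oracle.ofLanguage_apply, encodeBool, Option.some.injEq]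
    change [L₂.boolIndicator (f x)].headD false = L₁.boolIndicator x
    rw [List.headD_cons]
    rcases Bool.eq_false_or_eq_true (L₁.boolIndicator x) with h1 | h1
    · rw [h1]
      exact (Set.mem_iff_boolIndicator _ _).1
        ((hL x).1 ((Set.mem_iff_boolIndicator _ _).2 h1))
    · rw [h1]
      exact (Set.notMem_iff_boolIndicator _ _).1
        (fun h => (Set.notMem_iff_boolIndicator _ _).2 h1 ((hL x).2 h))
  · intro y hy
    rw [List.mem_singleton] at hy
    subst hy
    have := (hM x).length_le
    simp only [id] at this
    omega

/-- **`A ∈ P^A`**, discharge of the named fact `self_mem_PRel_ofLanguage`: the identity is a Karp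
reduction of `A` to itself (`PolyTimeKarpReducible.refl`), hence a Cook reduction
(`PolyTimeKarpReducible.turing_holds`): query the input itself and output the answer bit.
[Ladner–Lynch–Selman 1975, §2, Prop. 2.1 (reflexivity); Baker–Gill–Solovay 1975, §1]
[cite: LadnerLynchSelman1975, p. 104 and Prop. 2.1] -/
theorem self_mem_PRel_ofLanguage_holds : self_mem_PRel_ofLanguage :=
  fun A => PolyTimeKarpReducible.turing_holds (PolyTimeKarpReducible.refl A)

/-- **Reflexivity of `≤ᵀₚ`**, discharge of the named fact `polyTimeTuringReducible_refl`.
[Ladner–Lynch–Selman 1975, §2, Prop. 2.1(i)]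
[cite: LadnerLynchSelman1975, p. 104 and Prop. 2.1] -/
theorem polyTimeTuringReducible_refl_holds : polyTimeTuringReducible_refl :=
  fun A => PolyTimeKarpReducible.turing_holds (PolyTimeKarpReducible.refl A)

/-! ### Query-free oracle algorithms: `isPolyTime_ofFun`, `P ⊆ P^O` -/

namespace ConsTM

/-- The one-statement machine `push b; halt` on a single `Bool` stack: it computes
`List.cons b` in one step. [folklore] -/
def machine (b : Bool) : FinTM2 where
  K := Unit
  k₀ := ()
  k₁ := ()
  Γ _ := Bool
  Λ := Unit
  main := ()
  σ := Unit
  initialState := ()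
  m _ := TM2.Stmt.push () (fun _ => b) TM2.Stmt.halt

/-- The bundled machine `push b; halt` (alphabets `Bool`, identity identifications). [folklore] -/
def lift (b : Bool) : TM2ComputableAux Bool Bool where
  tm := machine b
  inputAlphabet := Equiv.refl Bool
  outputAlphabet := Equiv.refl Bool

/-- `push b; halt` maps `l` to `b :: l` within one step. [folklore] -/
theorem outputsWithin (b : Bool) (l : List Bool) : (lift b).OutputsWithin l (b :: l) 1 := by
  refine ⟨⟨⟨1, ?_⟩, le_rfl⟩⟩
  change (machine b).step (initList (machine b) (l.map (Equiv.refl Bool).symm)) =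
    some (haltList (machine b) (b :: l.map (Equiv.refl Bool).symm))
  rw [TM2Comp.initList_eq, TM2Comp.haltList_eq]
  simp only [FinTM2.step, TM2.step, machine, TM2.stepAux, Function.update_self,
    Function.update_idem]
  rfl

end ConsTM

/-- Tagging with `Sum.inr` is polynomial-time: w.r.t. `eb` on the source and the tagged
encoding `(encodingList Bool).sumBool eb` on the target it is the string map `s ↦ 1 s`
(machine `push true; halt`, time `1`). [Arora–Barak 2009, §0.1, §1.2]
[cite: AroraBarak2009, §1.2] -/
theorem polyTimeComputable_sumInr {β : Type} (eb : Encoding β Bool) :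
    PolyTimeComputable eb.encode ((encodingList Bool).sumBool eb).encode
      (Sum.inr : β → List Bool ⊕ β) :=
  ⟨1, ConsTM.lift true, fun y => by
    change (ConsTM.lift true).OutputsWithin (eb.encode y) (true :: eb.encode y)
      (Polynomial.eval (eb.encode y).length 1)
    rw [eval_one]
    exact ConsTM.outputsWithin true (eb.encode y)⟩

/-- A polynomial-time `f` stays polynomial-time when read off the first component of the
`boolPair`-encoded pair (input, transcript): run the machine of `f` on `(boolUnpair w).1`
(`boolUnpairFstLift`, `NondeterministicProofs.lean`), time `p n + (n + 3)`.
[Arora–Barak 2009, Claim 2.4 (ignore the second component)] [cite: AroraBarak2009, Claim 2.4] -/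
theorem polyTimeComputable_comp_fst {β : Type} {eb : Encoding β Bool} {f : List Bool → β}
    (hf : PolyTimeComputable (id : List Bool → List Bool) eb.encode f) :
    PolyTimeComputable
      (fun p : List Bool × List (List Bool) =>
        boolPair p.1 ((encodingList Bool).listBool.encode p.2))
      eb.encode (f ∘ Prod.fst) := by
  obtain ⟨p, M, hM⟩ := hf
  refine ⟨p + (X + 3), boolUnpairFstLift M, fun q => ?_⟩
  have hx : (boolUnpair (boolPair q.1 ((encodingList Bool).listBool.encode q.2))).1 = q.1 := by
    rw [boolUnpair_boolPair]
  have h : M.OutputsWithin (boolUnpair (boolPair q.1 ((encodingList Bool).listBool.encode q.2))).1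
      (eb.encode (f q.1)) (p.eval q.1.length) := by
    rw [hx]
    exact hM q.1
  change (boolUnpairFstLift M).OutputsWithin
    (boolPair q.1 ((encodingList Bool).listBool.encode q.2)) (eb.encode (f q.1))
    (Polynomial.eval (boolPair q.1 ((encodingList Bool).listBool.encode q.2)).length (p + (X + 3)))
  refine (outputsWithin_boolUnpairFstLift M h).mono ?_
  -- monotonicity of evaluation of an `ℕ`-polynomial (cf. `isPolyTime_karpAlg`)
  have hmono : ∀ (r : Polynomial ℕ) {a b : ℕ}, a ≤ b → r.eval a ≤ r.eval b := by
    intro r a b hab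
    induction r using Polynomial.induction_on' with
    | add p q hp hq => simp only [eval_add]; exact Nat.add_le_add hp hq
    | monomial n c =>
      simp only [eval_monomial]
      exact Nat.mul_le_mul_left c (Nat.pow_le_pow_left hab n)
  simp only [eval_add, eval_X, eval_ofNat]
  have := hmono p (show q.1.length ≤
    (boolPair q.1 ((encodingList Bool).listBool.encode q.2)).length by
      rw [length_boolPair]; omega)
  omega

/-- **Discharge of `OracleAlg.isPolyTime_ofFun`.** The step function of the query-free
algorithm `ofFun f` is `Sum.inr ∘ f ∘ Prod.fst` on the encoded pair; compose
`polyTimeComputable_comp_fst` with the tagging machine (`polyTimeComputable_sumInr`) by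
`PolyTimeComputable.comp_holds`. [Baker–Gill–Solovay 1975, §1 (`P ⊆ P^X`)]
[cite: BakerGillSolovay1975, §1] -/
theorem OracleAlg.isPolyTime_ofFun_holds {β : Type} : @OracleAlg.isPolyTime_ofFun β := by
  intro f eb hf
  exact PolyTimeComputable.comp_holds (polyTimeComputable_sumInr eb) (polyTimeComputable_comp_fst hf)

/-- **`P ⊆ P^O` for every oracle**, discharge of the named fact `P_subset_PRel`: a
polynomial-time decider is a query-free oracle algorithm (`OracleAlg.ofFun`, one round, no
queries; `mem_P_iff_holds`, `isPolyTime_ofFun_holds`). [Baker–Gill–Solovay 1975, §1]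
[cite: BakerGillSolovay1975, §1] -/
theorem P_subset_PRel_holds : P_subset_PRel := by
  intro O L hL
  refine ⟨OracleAlg.ofFun L.boolIndicator,
    OracleAlg.isPolyTime_ofFun_holds (polyTimeDecidable_iff.1 (mem_P_iff_holds.1 hL)), 1,
    fun x => ⟨?_, ?_⟩⟩
  · rw [Polynomial.eval_one]
    rfl
  · simp

/-- **`P ⊆ P^C` for every nonempty class `C`**, discharge of the named fact
`P_subset_PRelClass` (from `P_subset_PRel_holds`). [Baker–Gill–Solovay 1975, §1]
[cite: BakerGillSolovay1975, §1] -/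
theorem P_subset_PRelClass_holds : P_subset_PRelClass := by
  intro _ hC
  obtain ⟨A, hA⟩ := hC
  intro L hL
  exact mem_PRelClass_iff.2 ⟨A, hA, P_subset_PRel_holds _ hL⟩

/-- **`C ⊆ P^C`**, discharge of the named fact `self_subset_PRelClass` (from reflexivity of
`≤ᵀₚ`, `polyTimeTuringReducible_refl_holds`). [Baker–Gill–Solovay 1975, §1]
[cite: BakerGillSolovay1975, §1] -/
theorem self_subset_PRelClass_holds : self_subset_PRelClass :=
  fun _ A hA => mem_PRelClass_iff.2 ⟨A, hA, polyTimeTuringReducible_refl_holds A⟩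

end Literature.Computability.Complexity
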